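import Summits.QuantumFields.BalabanUV.T4Continuum.Spine.NE1p.DressedTransportAssembledModWin
import Summits.QuantumFields.BalabanUV.T4Continuum.Spine.NE1p.DressedTransportAssembledModData

/-!
# T⁴ programme, spine estimate NE1′ (node O3b/H2) — END-F′-mod-win OVER CANONICAL DATA: the moduli face of the assembled transport
# leaf under PER-STEP chart windows, with NO bookkeeping functions displayed (swarm row S2 «END-F′ plumbing» of
# `t4/formal/NE1p/LEAVES.md`, supplier item S2j «mod-win ∘ canonical» of the same seat; the «canonical» factor of the terminal
# object «END-ALL over (mod ∘ canonical ∘ slice-win ∘ schedule-win)» of `t4/formal/NE1p/DAG.md` v1.3 §3, one step further in)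

Cell `pub-balaban`, sub-cell `t4`, BINDER-OWNERS row NE1′, NE1′ FORMALISATION SWARM `b2b-balaban-t4-ne1p-formalise-*`, leaf
prover 01 (unit `b2b-balaban-t4-ne1p-formalise-leaf-01`, gen 2); owner lineage t4-ne1p-p1 (skeleton `t4/skeletons/NE1p-t4-ne1p-p1.md`
v1.1 §6 seat S2); tree target `Summits/QuantumFields/BalabanUV/T4Continuum/Spine/NE1p/`; ADDITIVE — imports leaf-08's per-step-window
moduli face `Spine/NE1p/DressedTransportAssembledModWin` (END-F′-mod-win `transportLeaf_assembled_mod_win`, p213818) and this seat's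
`Spine/NE1p/DressedTransportAssembledModData` (the canonical data `aszRec`/`s1Mod` + `rsOf`/`rsOf_dec`, p213820) ONLY; modifies nothing.

WHY.  END-F′-mod-win (leaf-08, row S2h: the moduli route R-a′ under the per-step bond-ball windows of END-F-win R-b) carries the
same three FREE bookkeeping functions as END-F′-mod — the closed-form step budget `s1` (`hs1`), the slice sizes `Asz`
(`hAsz_birth`/`hAsz_step`) and the slice radii `rs` (`hrs_birth`/`hrs_step`, ordered by `hrs_dec`) — constrained by equalities
«the instantiation defines».  `DressedTransportAssembledModData` determined them once by plain recursions on the scale; this file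
is the two-line substitution on the per-step-window face:
* **`transportLeaf_assembled_mod_win_canonical`** [bookkeeping] — `transportLeaf_assembled_mod_win` with `rs := rsOf r ϱ`,
  `Asz := aszRec T.gen s (s1Mod T.gen r α c Sg δf)`, `s1 := s1Mod T.gen r α c Sg δf`: the SIX bookkeeping binders `hs1`/`hAsz_birth`/
  `hAsz_step`/`hrs_birth`/`hrs_step`/`hrs_dec` are GONE (and `s1`/`rs`/`Asz` leave the signature), replaced by the schedule
  inequalities `hϱ_birth : ϱ f k″ k″ < r`, `hϱ_succ : ϱ f k″ (k+1) < ϱ f k″ k`; `hmargin`'s last clause reads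
  `ϱ₁ b k ≤ rsOf r ϱ p.1 p.2 k`; every other binder is END-F′-mod-win's VERBATIM — in particular the per-step window data `hN2`
  (guard `latN p ≤ wk b k′ (k+1)`), `hθwk`, `hwk`, `hwk_anti`, `hdefwk`, `hδfwk`, and the cross-family margins `hN2cx`/`hpairx`
  STILL at the uniform slice window `w` (located finding F-ne1pleaf04-1 = LF-2: for bond-ball schedules the assembled leaf's birth
  window is `≥ K·w + Σ_k (ϱ₁ k + σ k)` on this face; the per-step SLICE-window cure is leaf-04's row S1e, not this file).
  Conclusion: VERBATIM the field type of `BookingLeaves.htr` (`C = 4c_δ/r`, `ρ i = ψ·α i`).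
Along a step-indexed schedule `ϱ f k″ k := W.ϱc k` the canonical radius `rsOf r ϱ` is leaf-04's `WindowScheduleModWin.sliceRadius`
∕ row S1's `WindowSchedule.sliceR` (leaf-03-g2's `DressedTransportCanonicalScheduled.rsOf_eq_sliceR`), so the schedule files'
`hmargin_mod_of_schedule`-type lemmas feed `hmargin` here after one rewrite — not done here.

HONEST FRAMING.  Rung (B)+1 bookkeeping on ONE finite four-torus of fixed physical size — NOT infinite volume, NOT a mass gap, NOT
OS on ℝ⁴, NOT the Clay problem, NOT summit progress.  NE1′ is NOT PRINTED and NOT PROVED; headline «L-T ⇐ F-1, F-2 (+ the H2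
dictionary `hQ`/`hSg`), F-3, F-5…F-9 on the per-step-window moduli face, with no bookkeeping functions displayed», never «NE1′
proved»; every wall binder of `t4/T4-EST-NE1p-P1.md` §4 stays DISPLAYED ((w1) `hsl`, (w2-act) `hB`/`hE` — printed TYPE
[Balaban1989LargeFieldII] (1.65) p. 375, (1.71)–(1.75) pp. 379–380, asserted for Bałaban's densities NOWHERE —, (w3)⁺ nesting and
margins, (w4) `hdom`, (I4′) `hrate`/`hδf`, attainment, invariance); 0 binders are instantiated on Bałaban's densities; no `def`, no
`def … : Prop`; [folklore] kernel glue, 0 sorry, 0 citations used as hypothesis-free facts.  Spine PROVED 0∕9 unchanged.  HONEST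
DEPENDENCY: continuum YM on T⁴ ⇐ BetaPertH ∧ nine spine estimates (0/9 proved); BetaPertH ⇐ (D1) ∧ (D4) ∧ CAP+tail; G-an2-4 gates
asym, D1 and NE2/3/4.
-/

noncomputable section

namespace Summit.QuantumFields.BalabanUV.T4Continuum.NE1p.DressedTransportAssembledModWinData

open MeasureTheory Set Metric Filter Finset
open scoped BigOperators
open Literature.MathematicalPhysics.QuantumFieldTheory.Balaban1983to89
open Literature.MathematicalPhysics.QuantumFieldTheory.Balaban1983to89.T4TermFormat
open Literature.MathematicalPhysics.QuantumFieldTheory.Balaban1983to89.T4TermFormat.Booking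
open Literature.MathematicalPhysics.QuantumFieldTheory.Balaban1983to89.T4GatedBooking
open Literature.MathematicalPhysics.QuantumFieldTheory.Balaban1983to89.T4TrajectoryComparison
open Literature.MathematicalPhysics.QuantumFieldTheory.Balaban1983to89.T4TrajectoryModulus
open Summit.QuantumFields.BalabanUV.T4Continuum.T4TrajectoryDensityDressed
open Summit.QuantumFields.BalabanUV.T4Continuum.NE1p.DressedRoot
open Summit.QuantumFields.BalabanUV.T4Continuum.NE1p.DressedTransportAssembled
open Summit.QuantumFields.BalabanUV.T4Continuum.NE1p.DressedTransportAssembledData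
open Summit.QuantumFields.BalabanUV.T4Continuum.NE1p.DressedTransportAssembledMod
open Summit.QuantumFields.BalabanUV.T4Continuum.NE1p.DressedTransportAssembledModWin
open Summit.QuantumFields.BalabanUV.T4Continuum.NE1p.DressedTransportAssembledModData
open T4BirthChartTransport (GaugeInvariant BirthSlice RelGauge)
open T4BlockTransport (Fld NDir latMove latN latMove_zero)
open T4TrajectoryDensity

/-! ## END-F′-mod-win over the canonical data [bookkeeping] -/

section FunctionLevel

variable {B : T4TermFormat.Booking} {T : Trajectory B}
variable {R : Type*} [NormedRing R] [NormedAlgebra ℂ R] [MeasurableSpace R] {d : ℕ}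

/-- **END-F′-mod-win OVER THE CANONICAL DATA — THE TRANSPORT LEAF `htr` OF `BookingLeaves` ON THE PER-STEP-WINDOW MODULI FACE WITH
NO BOOKKEEPING FUNCTIONS DISPLAYED** [bookkeeping]: leaf-08's `DressedTransportAssembledModWin.transportLeaf_assembled_mod_win`
(END-F′-mod-win) with `rs := rsOf r ϱ`, `Asz := aszRec T.gen s (s1Mod T.gen r α c Sg δf)`, `s1 := s1Mod T.gen r α c Sg δf`; its six
bookkeeping binders `hs1`/`hAsz_birth`/`hAsz_step`/`hrs_birth`/`hrs_step`/`hrs_dec` are the data lemmas of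
`DressedTransportAssembledModData` (`s1Mod_eq`, `aszRec_birth`, `aszRec_succ`, `rsOf_birth`, `rsOf_succ`, `rsOf_dec`), so they
DISAPPEAR together with the free functions `s1`/`rs`/`Asz`; the schedule enters through `hϱ_birth : ϱ f k″ k″ < r` and
`hϱ_succ : ϱ f k″ (k+1) < ϱ f k″ k` only.  Displayed binders: END-F-win's wall items (F-1 `hsl`; F-2 `hFn`/`h𝒢` and the H2 dictionary
`hQ`/`hSg`; F-3 `hB`/`hE`; F-5 `hN1`/`hN2` (per-step guard `latN p ≤ wk b k′ (k+1)`)/`hdiam`/`hθ`/`hθwk`/`hwk`/`hwk_anti`/`hN1x`/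
`hN2cx`/`hmargin` (over `rsOf r ϱ`)/`hϱ_birth`/`hϱ_succ`; F-6 `hrate`/`hdefwk`/`hδf`/`hδfwk`/`hpairx`; F-7 `hdom`; F-8 `hlin`; F-9
`hα`/`hr`/`hw`/`hcδ`/`hψ`/`hD`/`hϱ`/`hDμ`; measurability `hmeas`; invariance `hinv`) and the ONE cutoff-free scalar condition
`hcm : ‖c b k‖ ≤ m`.  NO `hP`, NO `hs`, NO budget binder, NO radius floor, NO bookkeeping equality.  The cross-family margins
`hN2cx`/`hpairx` keep the UNIFORM slice window `w` (finding F-ne1pleaf04-1 = LF-2 applies verbatim; cure = row S1e).  Conclusion: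
EXACTLY the field `htr` of `BookingLeaves` (`C = 4c_δ/r`, `ρ i = ψ·α i`).  Nothing of Bałaban's densities is asserted. [folklore] -/
theorem transportLeaf_assembled_mod_win_canonical {Fn : B.Birth → ℕ → ℕ → Fld d R → ℂ}
    {rel : B.Birth → ℕ → ℕ → Fld d R → Fld d R → Prop} {𝒦 : B.Birth → ℕ → ℕ → Set (Fld d R)}
    {ref : B.Birth → ℕ → Fld d R → Fld d R} {base : B.Birth → ℕ → Fld d R → ℝ}
    {𝒜 𝒬 : B.Birth → ℕ → Fld d R → Fld d R → ℂ} {q : B.Birth → ℕ → Fld d R → ℂ}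
    {μ : B.Birth → ℕ → Measure (Fld d R)} {z₀ z₁ : B.Birth → ℕ → Fld d R} {D : B.Birth → ℕ → Set (Fld d R)}
    {defect : B.Birth → ℕ → ℕ → ℝ} {cδ ψ w r m : ℝ} {s θ ϱ₁ : B.Birth → ℕ → ℝ} {α : ℕ → ℝ}
    {ϱ wk : B.Birth → ℕ → ℕ → ℝ} {S : ℕ → B.Birth → Finset B.Birth}
    {Sg : ℕ → B.Birth → Finset (B.Birth × ℕ)} {c : B.Birth → ℕ → ℂ} {δf : B.Birth → ℕ → B.Birth × ℕ → ℝ}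
    (hα : ∀ i, 0 ≤ α i) (hr : 0 < r) (hw : 0 < w) (hcδ : 0 ≤ cδ) (hψ : 0 ≤ ψ)
    (hsl : ∀ (b : B.Birth) (k' : ℕ), B.birthScale b ≤ k' → k' ≤ B.K →
      RanBelow (budgetGate T s m S (4 * cδ / r) (fun i => ψ * α i)) k' →
      BirthSlice (Fn b k' k') latMove latN (𝒦 b k' k') w r (T.gen b k'))
    (hFn : ∀ (b : B.Birth) (k' k : ℕ), B.birthScale b ≤ k' → k' ≤ k → k + 1 ≤ B.K →
      RanBelow (budgetGate T s m S (4 * cδ / r) (fun i => ψ * α i)) (k + 1) →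
      ∀ U, Fn b k' (k + 1) U =
        wOp (expWeight (base b k) (𝒜 b k + 𝒬 b k)) (μ b k) (z₀ b k) U (fun z => Fn b k' k (U + z)))
    (h𝒢 : ∀ (b : B.Birth) (k' k : ℕ), B.birthScale b ≤ k' → k' ≤ k → k + 1 ≤ B.K →
      RanBelow (budgetGate T s m S (4 * cδ / r) (fun i => ψ * α i)) (k + 1) →
      ∀ U, (fun z => Fn b k' k (U + z)) ∈ BddClass ℂ (μ b k))
    (hD : ∀ b k, (D b k).Nonempty) (hϱ : ∀ b k' k, 0 < ϱ b k' k)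
    (hB : ∀ (b : B.Birth) (k' k : ℕ), B.birthScale b ≤ k' → k' ≤ k → k + 1 ≤ B.K →
      RanBelow (budgetGate T s m S (4 * cδ / r) (fun i => ψ * α i)) (k + 1) →
      RealBaseAt (ref b k) (base b k) (𝒜 b k) (μ b k) (𝒦 b k' (k + 1)))
    (hE : ∀ (b : B.Birth) (k' k : ℕ), B.birthScale b ≤ k' → k' ≤ k → k + 1 ≤ B.K →
      RanBelow (budgetGate T s m S (4 * cδ / r) (fun i => ψ * α i)) (k + 1) →
      ExponentSliceAt (ref b k) (𝒜 b k) (μ b k) latMove latN (𝒦 b k' (k + 1)) w (ϱ b k' k) (s b k))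
    -- the Assembly's dictionary: the centred observable-attached exponent IS the fresh sum over the live generations
    (hQ : ∀ b k, (fun U z => 𝒬 b k U z - q b k U) =
      fun U z => c b k * ∑ p ∈ Sg k b, (Fn p.1 p.2 k (U + z) - Fn p.1 p.2 k (U + z₁ b k)))
    (hSg : ∀ k b, ∀ p ∈ Sg k b, p.1 ∈ S k b ∧ B.birthScale p.1 ≤ p.2 ∧ p.2 ≤ k)
    -- the schedule: shrinking chart radii (F-5), below the birth radius from the start
    (hϱ_birth : ∀ (f : B.Birth) (k'' : ℕ), B.birthScale f ≤ k'' → ϱ f k'' k'' < r)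
    (hϱ_succ : ∀ (f : B.Birth) (k'' k : ℕ), B.birthScale f ≤ k'' → k'' ≤ k → ϱ f k'' (k + 1) < ϱ f k'' k)
    (hmargin : ∀ (b : B.Birth) (k' k : ℕ), B.birthScale b ≤ k' → k' ≤ k →
      ϱ b k' k < ϱ₁ b k ∧ 0 < ϱ₁ b k ∧ ∀ p ∈ Sg k b, ϱ₁ b k ≤ rsOf r ϱ p.1 p.2 k)
    -- the cutoff-free source-vs-budget condition
    (hcm : ∀ b k, ‖c b k‖ ≤ m)
    (hδf : ∀ b k, ∀ p ∈ Sg k b, 0 ≤ δf b k p ∧ δf b k p ≤ cδ * ψ ^ (k - p.2))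
    (hδfwk : ∀ b k, ∀ p ∈ Sg k b, δf b k p ≤ wk p.1 p.2 k)
    (hDμ : ∀ b k, ∀ᵐ z ∂μ b k, z ∈ D b k)
    (hN1 : ∀ (b : B.Birth) (k' k : ℕ), B.birthScale b ≤ k' → k' ≤ k → k + 1 ≤ B.K →
      ∀ z ∈ D b k, ∀ U ∈ 𝒦 b k' (k + 1), U + z ∈ 𝒦 b k' k)
    -- (N2) RE-CUT: chart motions of declared bound ≤ the NEXT step's window only
    (hN2 : ∀ (b : B.Birth) (k' k : ℕ), B.birthScale b ≤ k' → k' ≤ k → k + 1 ≤ B.K →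
      ∀ U₀ ∈ 𝒦 b k' (k + 1), ∀ p : NDir d R, latN p ≤ wk b k' (k + 1) → ∀ z' ∈ D b k,
        latMove U₀ p 1 + z' ∈ 𝒦 b k' k)
    (hN1x : ∀ (b : B.Birth) (k' k : ℕ), B.birthScale b ≤ k' → k' ≤ k →
      ∀ p ∈ Sg k b, ∀ z ∈ D b k, ∀ U ∈ 𝒦 b k' (k + 1), U + z ∈ 𝒦 p.1 p.2 k)
    (hN2cx : ∀ (b : B.Birth) (k' k : ℕ), B.birthScale b ≤ k' → k' ≤ k →
      ∀ p ∈ Sg k b, ∀ U₀ ∈ 𝒦 b k' (k + 1), ∀ pd : NDir d R, 0 < latN pd → latN pd ≤ w →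
        ∀ t ∈ tube (ϱ₁ b k / latN pd), latMove U₀ pd t + z₁ b k ∈ 𝒦 p.1 p.2 k)
    (hpairx : ∀ (b : B.Birth) (k' k : ℕ), B.birthScale b ≤ k' → k' ≤ k →
      ∀ p ∈ Sg k b, ∀ U₀ ∈ 𝒦 b k' (k + 1), ∀ pd : NDir d R, 0 < latN pd → latN pd ≤ w →
        ∀ᵐ z ∂μ b k, ∀ t ∈ tube (ϱ₁ b k / latN pd),
          RelGauge (rel p.1 p.2 k) latMove latN (latMove U₀ pd t + z₁ b k) (latMove U₀ pd t + z) (δf b k p))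
    (hdiam : ∀ b k, ∀ z ∈ D b k, ∀ z' ∈ D b k, ∀ x ν, ‖z x ν - z' x ν‖ ≤ θ b k)
    (hθ : ∀ b k, 0 < θ b k ∧ θ b k ≤ w) (hθwk : ∀ b k' k, θ b k ≤ wk b k' k)
    (hwk : ∀ b k' k, wk b k' k ≤ w) (hwk_anti : ∀ b k' k, wk b k' (k + 1) ≤ wk b k' k)
    (hdom : ∀ (b : B.Birth) (k' k : ℕ), B.birthScale b ≤ k' → k' ≤ k → k + 1 ≤ B.K →
      Real.exp 3 * (1 + 4 * θ b k / ϱ b k' k) ≤ α k)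
    (hinv : ∀ b k' k, GaugeInvariant (rel b k' k) (Fn b k' k))
    (hmeas : ∀ (b f : B.Birth) (k'' k : ℕ) (U : Fld d R), AEStronglyMeasurable (fun z => Fn f k'' k (U + z)) (μ b k))
    (hdefwk : ∀ b k' k, defect b k' k ≤ wk b k' k)
    (hrate : ∀ (b : B.Birth) (k' k : ℕ), B.birthScale b ≤ k' → k' ≤ k → k ≤ B.K →
      defect b k' k ≤ cδ * ψ ^ (k - k'))
    (hlin : ∀ (b : B.Birth) (k' k : ℕ), B.birthScale b ≤ k' → k' ≤ k → k ≤ B.K →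
      RanBelow (budgetGate T s m S (4 * cδ / r) (fun i => ψ * α i)) k → ∀ ε > 0,
      ∃ U₀ ∈ 𝒦 b k' k, ∃ U₁ : Fld d R, RelGauge (rel b k' k) latMove latN U₀ U₁ (defect b k' k) ∧
        T.lin b k' k ≤ ‖Fn b k' k U₁ - Fn b k' k U₀‖ + ε) :
    T.TransportsFromVar (4 * cδ / r) (fun i => ψ * α i) (budgetGate T s m S (4 * cδ / r) (fun i => ψ * α i)) :=
  transportLeaf_assembled_mod_win (rs := rsOf r ϱ) (Asz := aszRec T.gen s (s1Mod T.gen r α c Sg δf))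
    (s1 := s1Mod T.gen r α c Sg δf) hα hr hw hcδ hψ hsl hFn h𝒢 hD hϱ hB hE hQ hSg (s1Mod_eq T.gen r α c Sg δf)
    (aszRec_birth T.gen s (s1Mod T.gen r α c Sg δf)) (rsOf_birth r ϱ)
    (fun f _ _ _ hk => aszRec_succ T.gen s (s1Mod T.gen r α c Sg δf) f hk) (fun f _ _ _ hk => rsOf_succ r ϱ f hk)
    (rsOf_dec hϱ_birth hϱ_succ) hmargin hcm hδf hδfwk hDμ hN1 hN2 hN1x hN2cx hpairx hdiam hθ hθwk hwk hwk_anti hdom hinv hmeas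
    hdefwk hrate hlin

end FunctionLevel

end Summit.QuantumFields.BalabanUV.T4Continuum.NE1p.DressedTransportAssembledModWinData

end
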